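import Literature.NumberTheory.GaloisRepresentations.LubinTateColemanUnitsImageTraceGaloisScalarTwo
import HarnessLib

/-!
# The FRAME MATRIX of a pair of Galois elements on the (c)-capstone's module: for `σ̃₁, σ̃₂ ∈ Γ_{K_v}` there are a matrix
# `A = (c′₁ c′₂; c₁ c₂) ∈ M₂(ℤ₂)` and signs `k₁, k₂ ≤ 1` with `[Σ Col(σ̃ᵢ·β)] = (ε^{kᵢ} · frameSubstRingHom 𝒪 A (1 + Tᵢ)) • [Σ Col β]` in `(N_Σ/C)_ε`
# — pin (U5) («`1 + Tᵢ` acts as `γ̃ᵢ`») for the `ℤ₂⟦T₁,T₂⟧`-structure `unitTwist₂(ε^{k₁},ε^{k₂}) ∘ frameSubstRingHom A` on the Coleman side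

De Shalit, *Iwasawa theory of elliptic curves with complex multiplication* (1987), Ch. I §3.1 (`ℤ_p⟦𝒢⟧ = Λ[Δ]`, generators ↦ `1 + S`); Neukirch–Schmidt–Wingberg
(5.3.5) (`𝒪⟦ℤ_p²⟧ ≅ 𝒪⟦T₁,T₂⟧` depends on the generators).  This file only PACKAGES `LubinTateColemanUnitsImageTraceGaloisScalarTwo.exists_unitsImageTrace_mk_galAct_eq_smul`
(one `σ̃`) for a PAIR, writing the two scalars as the images of the generators `1 + T₁ = 1 + X`, `1 + T₂ = 1 + C X` of `𝒪⟦T₂⟧⟦T₁⟧` under the tree's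
frame substitution `IwasawaAlgebra₂.frameSubstRingHom 𝒪 A` (`LubinTateColemanCoinvariantGaloisScalarTwo.frameSubstRingHom_generators_of_coords`).
Everything PROVED (0 sorry, no definitions).

* ★★★ **`exists_frameMatrix_unitsImageTrace_mk_galAct_pair`**.

## References
* E. de Shalit, *Iwasawa theory of elliptic curves with complex multiplication* (1987), Ch. I §3.1; Ch. III §1.3, §1.8 (14). [deShalit1987]
* J. Neukirch, A. Schmidt, K. Wingberg, *Cohomology of Number Fields*, 2nd ed. (2008), (5.3.5). [NeukirchSchmidtWingberg2008]
-/

noncomputable section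

open scoped PowerSeries.WithPiTopology

namespace Literature.NumberTheory.GaloisRepresentations

section UnitsImageTraceFrameTwo

open GaloisRepresentations.IsNonarchimedeanLocalField LubinTate ValuativeRel Field Finset
open Literature.NumberTheory.EllipticCurves

variable {F : Type} [Field F] [ValuativeRel F] [TopologicalSpace F] [IsNonarchimedeanLocalField F]

attribute [local instance] ltNormUniformSpace ltNormIsUniformAddGroup rk1 nF nE fintypeResidueField

variable {p : ℕ} [hp : Fact p.Prime] {d : ℕ} (hd : d.Coprime p)
variable {π : 𝒪[F]} (hπ : (valuation F).IsUniformizer (π : F))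
variable (E : ℕ → IntermediateField F (AlgebraicClosure F)) [∀ m, FiniteDimensional F (E m)] [∀ m, Normal F (E m)]
  [∀ m, IsGalois F (E m)] (hmono : Monotone E) (hE : ∀ m, E m ≤ maxUnramified F) (hdeg : ∀ m, Module.finrank F (E m) = d * p ^ m)
  {σ₀ : absoluteGaloisGroup F} (hσ₀ : IsAbsArithFrob σ₀) (hq : residueFieldCard F = 2)
variable (u : (LTCoeff F)ˣ) (hu : LTCoeff.of F π = residueFieldCard F * u) (γ : 𝒪[F]ˣ)
variable [IsAdicComplete (Ideal.span {intBase F (LTCoeff.of F π)}) (PowerSeries 𝒪[F])] [NeZero d]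
  [IsAdicComplete (Ideal.span {(p : 𝒪[F])}) 𝒪[F]]
variable {θ : ∀ m, unitBall (E m)} (hθ : ∀ m, IsIntegralNormalGen (E m) (θ m))
  (hcoh : ∀ m, unitBallTrace (hmono (Nat.le_succ m)) (θ (m + 1)) = θ m)
variable [CharZero F] (hI : Ideal.span {(p : 𝒪[F])} ≠ ⊤) (hud : ∀ m, (u : LTCoeff F) ^ Module.finrank F (E m) ≠ 1)
  (hm : ∃ m₁ : ℕ, LTCoeff.of F π ^ 2 ∣ LTCoeff.of F π - m₁)
variable {w : 𝒪[F]ˣ} (hγ : (γ : 𝒪[F]) = 1 + π ^ 2 * w)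

include hγ hm in
/-- ★★★ **The frame matrix of a pair.**  At `p = 2`, for `σ̃₁, σ̃₂ ∈ Γ_F` there are signs `k₁, k₂ ≤ 1` and a matrix `A ∈ M₂(ℤ₂)` — column `i` = (`2`-adic
`log_γ` of `(−1)^{kᵢ}χ_π(σ̃ᵢ)`, `2`-adic Frobenius exponent of `σ̃ᵢ`) — such that for every `C`, `ε` and every PRINCIPAL norm-coherent `β`, in
`N_Σ ⧸ (C ⊔ (σ_{−1} − ε)N_Σ)`:
**`[Σ Col(σ̃₁·β)] = (ε^{k₁} · frameSubstRingHom 𝒪 A (1 + T₁)) • [Σ Col β]`** and **`[Σ Col(σ̃₂·β)] = (ε^{k₂} · frameSubstRingHom 𝒪 A (1 + T₂)) • [Σ Col β]`**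
(`T₁ = X` outer = Lubin–Tate, `T₂ = C X` inner = unramified).  So the `ℤ₂⟦T₁,T₂⟧`-structure `Module.compHom (unitTwist₂(ε^{k₁}, ε^{k₂}) ∘ frameSubstRingHom A)`
on the capstone's module has `1 + Tᵢ` acting as `σ̃ᵢ`. [cite: deShalit1987, Ch. I §3.1; Ch. III §1.3, §1.8 (14)] [cite: NeukirchSchmidtWingberg2008, (5.3.5)] -/
theorem exists_frameMatrix_unitsImageTrace_mk_galAct_pair (hp2 : p = 2) [Algebra ℤ_[p] 𝒪[F]] (σ₁ σ₂ : absoluteGaloisGroup F) :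
    ∃ (k₁ k₂ : ℕ) (A : Matrix (Fin 2) (Fin 2) ℤ_[p]), k₁ ≤ 1 ∧ k₂ ≤ 1 ∧
      (∀ n : ℕ, ∃ j : ℕ, PadicInt.toZModPow n (A 0 0) = (j : ZMod (p ^ n)) ∧
        π ^ (n + 2) ∣ (-1) ^ k₁ * (lubinTateChar hπ σ₁ : 𝒪[F]) - (γ : 𝒪[F]) ^ j) ∧
      (∀ m, ∃ a : ℕ, (∀ x : E m, σ₁ • (x : AlgebraicClosure F) = (σ₀ ^ a) • (x : AlgebraicClosure F)) ∧
        PadicInt.toZModPow m (A 1 0) = (a : ZMod (p ^ m))) ∧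
      (∀ n : ℕ, ∃ j : ℕ, PadicInt.toZModPow n (A 0 1) = (j : ZMod (p ^ n)) ∧
        π ^ (n + 2) ∣ (-1) ^ k₂ * (lubinTateChar hπ σ₂ : 𝒪[F]) - (γ : 𝒪[F]) ^ j) ∧
      (∀ m, ∃ a : ℕ, (∀ x : E m, σ₂ • (x : AlgebraicClosure F) = (σ₀ ^ a) • (x : AlgebraicClosure F)) ∧
        PadicInt.toZModPow m (A 1 1) = (a : ZMod (p ^ m))) ∧
      ∀ (C : Submodule (PowerSeries (PowerSeries 𝒪[F])) (ColemanCoordModule hπ hq (intBase F) u hu γ)) (ε : PowerSeries (PowerSeries 𝒪[F]))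
        {β : ∀ m, RelNormCoherentUnits hπ (E m)} (hβ : ∀ m, (β (m + 1)).baseNorm hπ (hmono (Nat.le_succ m)) = β m)
        (hβ1 : ∀ m, ‖(((β m).val 0 : unitBall (E m ⊔ ltField π 0 : IntermediateField F (AlgebraicClosure F))) :
          (E m ⊔ ltField π 0 : IntermediateField F (AlgebraicClosure F))) - 1‖ < 1),
        (Submodule.Quotient.mk ⟨_, indexTraceₗ_colemanImage_galAct_mem_unitsImageTrace hd hπ E hmono hE hdeg hσ₀ hq u hu γ hθ hcoh hI hud hm hβ hβ1 σ₁⟩ :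
            ↥(unitsImageTrace hd hπ E hmono hE hdeg hσ₀ hq u hu γ hθ hcoh hI hud) ⧸
              coinvRel ε (unitTwistₗ hπ hq (intBase F) u hu γ (-1)) (unitsImageTrace hd hπ E hmono hE hdeg hσ₀ hq u hu γ hθ hcoh hI hud)
                (fun _ hG => unitTwistₗ_mem_unitsImageTrace hd hπ E hmono hE hdeg hσ₀ hq u hu γ hθ hcoh hI hud (-1) hG) C) =
          (ε ^ k₁ * IwasawaAlgebra₂.frameSubstRingHom 𝒪[F] A (1 + PowerSeries.X)) •
            Submodule.Quotient.mk ⟨_, indexTraceₗ_colemanImage_mem_unitsImageTrace hd hπ E hmono hE hdeg hσ₀ hq u hu γ hθ hcoh hI hud hm hβ hβ1⟩ ∧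
        (Submodule.Quotient.mk ⟨_, indexTraceₗ_colemanImage_galAct_mem_unitsImageTrace hd hπ E hmono hE hdeg hσ₀ hq u hu γ hθ hcoh hI hud hm hβ hβ1 σ₂⟩ :
            ↥(unitsImageTrace hd hπ E hmono hE hdeg hσ₀ hq u hu γ hθ hcoh hI hud) ⧸
              coinvRel ε (unitTwistₗ hπ hq (intBase F) u hu γ (-1)) (unitsImageTrace hd hπ E hmono hE hdeg hσ₀ hq u hu γ hθ hcoh hI hud)
                (fun _ hG => unitTwistₗ_mem_unitsImageTrace hd hπ E hmono hE hdeg hσ₀ hq u hu γ hθ hcoh hI hud (-1) hG) C) =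
          (ε ^ k₂ * IwasawaAlgebra₂.frameSubstRingHom 𝒪[F] A (1 + PowerSeries.C PowerSeries.X)) •
            Submodule.Quotient.mk ⟨_, indexTraceₗ_colemanImage_mem_unitsImageTrace hd hπ E hmono hE hdeg hσ₀ hq u hu γ hθ hcoh hI hud hm hβ hβ1⟩ := by
  have H₁ := exists_unitsImageTrace_mk_galAct_eq_smul hd hπ E hmono hE hdeg hσ₀ hq u hu γ hθ hcoh hI hud hm hγ hp2 σ₁
  have H₂ := exists_unitsImageTrace_mk_galAct_eq_smul hd hπ E hmono hE hdeg hσ₀ hq u hu γ hθ hcoh hI hud hm hγ hp2 σ₂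
  obtain ⟨k₁, c'₁, c₁, hk₁, hc'₁, hc₁, h₁⟩ := H₁
  obtain ⟨k₂, c'₂, c₂, hk₂, hc'₂, hc₂, h₂⟩ := H₂
  have HA := frameSubstRingHom_generators_of_coords 𝒪[F] c'₁ c'₂ c₁ c₂
  obtain ⟨hA₁, hA₂⟩ := HA
  refine ⟨k₁, k₂, Matrix.of ![![c'₁, c'₂], ![c₁, c₂]], hk₁, hk₂, hc'₁, hc₁, hc'₂, hc₂, fun C ε β hβ hβ1 => ⟨?_, ?_⟩⟩
  · have h := h₁ C ε hβ hβ1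
    rw [hA₁]; exact h
  · have h := h₂ C ε hβ hβ1
    rw [hA₂]; exact h

end UnitsImageTraceFrameTwo

end Literature.NumberTheory.GaloisRepresentations

end
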